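import Mathlib
import HarnessLib
import HarnessLib.Audit
import Summits.ValiantsHypothesis.ValiantsHypothesis.Theorems.LacunarySymmetroidMatrixDescartesConcavity

/-!
# ValiantsHypothesis / LacunarySymmetroid — crux `MatrixDescartes` (stmt-ValiantsHypothesis-18050, V1), LINE (A) «product_plus_one»:
# the concavity IDENTITY and the binomial-lead cell `BinomialLeadAtMostOne` (pen val-idea-25 g9 NOTE §56.10 (1); Sketch-T3-s59)

The `t`-picture identity behind the CONCAVITY CRITERION of module `…Concavity` (NOTE §56.7), made quantitative: for rows
`g_j = a₀ⱼ + a₁ⱼX^a + a₂ⱼX^c` and `Φ = ∏ g_j`, at every critical point `t > 0` of `Φ` off its roots,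
`t²·Φ(t)·Φ″(t) = Φ(t)²·(a(a−c)·M(t) − Σ_j (t g_j′(t)/g_j(t))²)` (`concavity_identity`; `M = middleSum`).  Consequences:
`concavityCriterion_of_nonneg` (`M ≥ 0` and one row with `t g_j′(t) ≠ 0` already force `Φ(t)Φ″(t) < 0`) and the pen's typed cell
`BinomialLeadAtMostOne` (Sketch `abprobe/s59/card/Sketch-T3-s59.lean` 9314ac29748a61d5, NOTE §56.10 (1) «C1», proved there on paper):
a BINOMIAL negative row `−α + γX^c` times ANY number of zero-change rows has AT MOST ONE positive critical point
(`binomialLeadAtMostOne`, the Sketch text VERBATIM) — below every Descartes bound.  Proof: no critical point where `g_W ≥ 0`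
(`Φ′ > 0` there); elsewhere every critical point is a strict local maximum of `|Φ|` by the identity (the W row contributes
`(cγt^c/g_W)² > 0`), and two adjacent such points would enclose a third.

HONEST FRAMING: exact free-standing helpers; NOT P6 / T3♯ / the floor law / `OneRowZeroChange k ≥ 2`; no stub of LINE (A) is touched
(A40 unchanged, sorries 4 → 4); `MatrixDescartes` OPEN; `VP ≠ VNP` is NOT proved and nothing here bears on it.
-/

set_option linter.dupNamespace false

namespace Summit.ValiantsHypothesis.ValiantsHypothesis.Theorems.LacunarySymmetroidMatrixDescartes

namespace ZeroChange

open Polynomial Finset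

/-! ## The identity -/

/-- **Concavity identity** (NOTE §56.7, `t`-picture): at a positive critical point `t` of `Φ = ∏_j g_j` off the roots,
`t²·Φ(t)·Φ″(t) = Φ(t)²·(a(a−c)·M(t) − Σ_j (t g_j′(t)/g_j(t))²)`. -/
theorem concavity_identity (m a c : ℕ) (co : Fin m → ℝ × ℝ × ℝ) {t : ℝ} (ht : 0 < t)
    (hΦ : (∏ j, row a c (co j).1 (co j).2.1 (co j).2.2).eval t ≠ 0)
    (hcrit : (derivative (∏ j, row a c (co j).1 (co j).2.1 (co j).2.2)).eval t = 0) :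
    t ^ 2 * ((∏ j, row a c (co j).1 (co j).2.1 (co j).2.2).eval t *
        (derivative (derivative (∏ j, row a c (co j).1 (co j).2.1 (co j).2.2))).eval t) =
      ((∏ j, row a c (co j).1 (co j).2.1 (co j).2.2).eval t) ^ 2 *
        ((a : ℝ) * ((a : ℝ) - c) * middleSum a c co t -
          ∑ j, (t * (derivative (row a c (co j).1 (co j).2.1 (co j).2.2)).eval t /
            (row a c (co j).1 (co j).2.1 (co j).2.2).eval t) ^ 2) := by
  classical
  set Φ : ℝ[X] := ∏ j, row a c (co j).1 (co j).2.1 (co j).2.2 with hΦdef'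
  set g : Fin m → ℝ[X] := fun j => row a c (co j).1 (co j).2.1 (co j).2.2 with hg
  have hΦdef : Φ = ∏ j, g j := rfl
  have hgt : ∀ j, (g j).eval t ≠ 0 := by
    intro j h0
    apply hΦ
    rw [hΦdef, eval_prod]
    exact prod_eq_zero (mem_univ j) h0
  set S : ℝ → ℝ := fun x => ∑ j, (derivative (g j)).eval x / (g j).eval x with hS
  have hnear : ∀ᶠ x in nhds t, ∀ j, (g j).eval x ≠ 0 := by
    rw [Filter.eventually_all]
    intro j
    exact ((g j).continuous_aeval.continuousAt (x := t)).eventually_ne (hgt j)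
  have hprod : ∀ x, (∀ j, (g j).eval x ≠ 0) → (derivative Φ).eval x = Φ.eval x * S x := by
    intro x hx
    rw [hΦdef, derivative_prod_finset, eval_finsetSum, eval_prod, hS, mul_sum]
    refine sum_congr rfl fun j _ => ?_
    rw [eval_mul, eval_prod, ← mul_prod_erase univ (fun i => (g i).eval x) (mem_univ j)]
    field_simp [hx j]
  set S' : ℝ := ∑ j, ((derivative (derivative (g j))).eval t * (g j).eval t -
      (derivative (g j)).eval t * (derivative (g j)).eval t) / (g j).eval t ^ 2 with hS'
  have hSderiv : HasDerivAt S S' t := by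
    rw [hS, hS']
    refine HasDerivAt.fun_sum fun j _ => ?_
    exact ((derivative (g j)).hasDerivAt t).fun_div ((g j).hasDerivAt t) (hgt j)
  have hΦ'' : (derivative (derivative Φ)).eval t = (derivative Φ).eval t * S t + Φ.eval t * S' := by
    have h1 : HasDerivAt (fun x => (derivative Φ).eval x) ((derivative (derivative Φ)).eval t) t :=
      (derivative Φ).hasDerivAt t
    have h2 : HasDerivAt (fun x => Φ.eval x * S x) ((derivative Φ).eval t * S t + Φ.eval t * S') t :=
      (Φ.hasDerivAt t).fun_mul hSderiv
    have heq : (fun x => (derivative Φ).eval x) =ᶠ[nhds t] fun x => Φ.eval x * S x :=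
      hnear.mono fun x hx => hprod x hx
    exact (h1.congr_of_eventuallyEq heq.symm).unique h2
  have hSt : S t = 0 := by
    have := hprod t hgt
    rw [hcrit] at this
    exact (mul_eq_zero.1 this.symm).resolve_left hΦ
  have hP : ∀ j, t * (derivative (g j)).eval t = (a : ℝ) * (co j).2.1 * t ^ a + (c : ℝ) * (co j).2.2 * t ^ c :=
    fun j => mul_eval_derivative_row a c _ _ _ t
  have hQ : ∀ j, t ^ 2 * (derivative (derivative (g j))).eval t =
      ((a : ℝ) ^ 2 - a) * (co j).2.1 * t ^ a + ((c : ℝ) ^ 2 - c) * (co j).2.2 * t ^ c :=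
    fun j => sq_mul_eval_derivative2_row a c _ _ _ t
  set M : ℝ := ∑ j, (co j).2.1 * t ^ a / (g j).eval t with hMdef
  set T : ℝ := ∑ j, (co j).2.2 * t ^ c / (g j).eval t with hTdef
  have hMeq : middleSum a c co t = M := rfl
  have hrel : (a : ℝ) * M + c * T = 0 := by
    have e1 : (a : ℝ) * M + c * T = ∑ j, ((a : ℝ) * (co j).2.1 * t ^ a + (c : ℝ) * (co j).2.2 * t ^ c) / (g j).eval t := by
      rw [hMdef, hTdef, mul_sum, mul_sum, ← sum_add_distrib]
      refine sum_congr rfl fun j _ => ?_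
      ring
    have e2 : ∑ j, ((a : ℝ) * (co j).2.1 * t ^ a + (c : ℝ) * (co j).2.2 * t ^ c) / (g j).eval t = t * S t := by
      rw [hS, mul_sum]
      refine sum_congr rfl fun j _ => ?_
      rw [← hP j, mul_div_assoc]
    rw [e1, e2, hSt, mul_zero]
  have step1 : t ^ 2 * S' = ∑ j, (t ^ 2 * (derivative (derivative (g j))).eval t / (g j).eval t -
      (t * (derivative (g j)).eval t / (g j).eval t) ^ 2) := by
    rw [hS', mul_sum]
    refine sum_congr rfl fun j _ => ?_
    have := hgt j
    field_simp
  have step2 : ∑ j, (t ^ 2 * (derivative (derivative (g j))).eval t / (g j).eval t -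
      (t * (derivative (g j)).eval t / (g j).eval t) ^ 2) =
      (∑ j, (((a : ℝ) ^ 2 - a) * (co j).2.1 * t ^ a + ((c : ℝ) ^ 2 - c) * (co j).2.2 * t ^ c) / (g j).eval t) -
      ∑ j, (t * (derivative (g j)).eval t / (g j).eval t) ^ 2 := by
    rw [← sum_sub_distrib]
    refine sum_congr rfl fun j _ => ?_
    rw [hQ j]
  have step3 : ∑ j, (((a : ℝ) ^ 2 - a) * (co j).2.1 * t ^ a + ((c : ℝ) ^ 2 - c) * (co j).2.2 * t ^ c) / (g j).eval t =
      ((a : ℝ) ^ 2 * M + (c : ℝ) ^ 2 * T) - ((a : ℝ) * M + c * T) := by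
    rw [hMdef, hTdef, mul_sum, mul_sum, mul_sum, mul_sum, ← sum_add_distrib, ← sum_add_distrib, ← sum_sub_distrib]
    refine sum_congr rfl fun j _ => ?_
    ring
  have hT : (c : ℝ) * T = -(a * M) := by linarith
  have hS'eq : t ^ 2 * S' = (a : ℝ) * ((a : ℝ) - c) * M - ∑ j, (t * (derivative (g j)).eval t / (g j).eval t) ^ 2 := by
    rw [step1, step2, step3, hrel, sub_zero, show (c : ℝ) ^ 2 * T = c * (c * T) by ring, hT]
    ring
  -- assemble
  rw [hΦ'', hcrit, zero_mul, zero_add, hMeq]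
  calc t ^ 2 * (Φ.eval t * (Φ.eval t * S')) = (Φ.eval t) ^ 2 * (t ^ 2 * S') := by ring
    _ = _ := by rw [hS'eq]

/-- **Concavity criterion, nonneg form**: at a positive critical point off the roots with `M ≥ 0` and `0 < a < c`, if SOME row has
`t·g_j′(t) ≠ 0` then `Φ(t)·Φ″(t) < 0` (strict local maximum of `|Φ|`). -/
theorem concavityCriterion_of_nonneg (m a c : ℕ) (ha : 0 < a) (hac : a < c) (co : Fin m → ℝ × ℝ × ℝ) {t : ℝ} (ht : 0 < t)
    (hΦ : (∏ j, row a c (co j).1 (co j).2.1 (co j).2.2).eval t ≠ 0)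
    (hcrit : (derivative (∏ j, row a c (co j).1 (co j).2.1 (co j).2.2)).eval t = 0)
    (hM : 0 ≤ middleSum a c co t)
    (hj : ∃ j, t * (derivative (row a c (co j).1 (co j).2.1 (co j).2.2)).eval t ≠ 0) :
    (∏ j, row a c (co j).1 (co j).2.1 (co j).2.2).eval t *
      (derivative (derivative (∏ j, row a c (co j).1 (co j).2.1 (co j).2.2))).eval t < 0 := by
  have hid := concavity_identity m a c co ht hΦ hcrit
  obtain ⟨j₀, hj₀⟩ := hj
  have hgt : ∀ j, (row a c (co j).1 (co j).2.1 (co j).2.2).eval t ≠ 0 := by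
    intro j h0
    apply hΦ
    rw [eval_prod]
    exact prod_eq_zero (mem_univ j) h0
  have hx : t * (derivative (row a c (co j₀).1 (co j₀).2.1 (co j₀).2.2)).eval t /
      (row a c (co j₀).1 (co j₀).2.1 (co j₀).2.2).eval t ≠ 0 := div_ne_zero hj₀ (hgt j₀)
  have hsum : 0 < ∑ j, (t * (derivative (row a c (co j).1 (co j).2.1 (co j).2.2)).eval t /
      (row a c (co j).1 (co j).2.1 (co j).2.2).eval t) ^ 2 :=
    lt_of_lt_of_le (by positivity) (single_le_sum (f := fun j => (t * (derivative (row a c (co j).1 (co j).2.1 (co j).2.2)).eval t /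
      (row a c (co j).1 (co j).2.1 (co j).2.2).eval t) ^ 2) (fun j _ => sq_nonneg _) (mem_univ j₀))
  have hac1 : (a : ℝ) < c := by exact_mod_cast hac
  have hac' : (a : ℝ) - c < 0 := by linarith
  have ha' : (0 : ℝ) < a := by exact_mod_cast ha
  have hneg : (a : ℝ) * ((a : ℝ) - c) * middleSum a c co t -
      ∑ j, (t * (derivative (row a c (co j).1 (co j).2.1 (co j).2.2)).eval t /
        (row a c (co j).1 (co j).2.1 (co j).2.2).eval t) ^ 2 < 0 := by
    nlinarith [mul_nonneg (mul_nonneg ha'.le (neg_nonneg.2 hac'.le)) hM]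
  have hΦ2 : 0 < ((∏ j, row a c (co j).1 (co j).2.1 (co j).2.2).eval t) ^ 2 := by positivity
  have ht2 : 0 < t ^ 2 := by positivity
  by_contra hge
  push Not at hge
  have : 0 ≤ t ^ 2 * ((∏ j, row a c (co j).1 (co j).2.1 (co j).2.2).eval t *
      (derivative (derivative (∏ j, row a c (co j).1 (co j).2.1 (co j).2.2))).eval t) := mul_nonneg ht2.le hge
  rw [hid] at this
  nlinarith [mul_pos hΦ2 (neg_pos.2 hneg)]

/-! ## The binomial-lead cell -/

/-- A row with `p > 0 ≤ q, s` is positive on `(0,∞)`. -/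
theorem eval_row_pos' {a c : ℕ} {p q s t : ℝ} (hp : 0 < p) (hq : 0 ≤ q) (hs : 0 ≤ s) (ht : 0 < t) :
    0 < (row a c p q s).eval t := by
  rw [show (row a c p q s).eval t = p + q * t ^ a + s * t ^ c by simp [row]]
  positivity

/-- A polynomial with nonnegative coefficients is nonnegative on `[0,∞)`. -/
private theorem eval_nonneg_of_coeff_nonneg {P : ℝ[X]} (h : ∀ n, 0 ≤ P.coeff n) {t : ℝ} (ht : 0 ≤ t) : 0 ≤ P.eval t := by
  rw [eval_eq_sum_range]
  exact sum_nonneg fun i _ => mul_nonneg (h i) (pow_nonneg ht i)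

/-- Sign of a function just right of a zero with positive derivative. -/
private theorem eventually_pos_right_of_hasDerivAt {f : ℝ → ℝ} {x f' : ℝ} (hf : HasDerivAt f f' x) (hx : f x = 0) (hf' : 0 < f') :
    ∃ δ > 0, ∀ y, x < y → y < x + δ → 0 < f y := by
  have ht := (hasDerivAt_iff_tendsto_slope.1 hf).eventually (lt_mem_nhds hf')
  rw [eventually_nhdsWithin_iff, Metric.eventually_nhds_iff] at ht
  obtain ⟨δ, hδ, hδ'⟩ := ht
  refine ⟨δ, hδ, fun y hxy hyδ => ?_⟩
  have hy : 0 < slope f x y := hδ' (by rw [Real.dist_eq, abs_of_pos (by linarith)]; linarith) (ne_of_gt hxy)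
  rw [slope_def_field, hx, sub_zero] at hy
  exact (div_pos_iff.1 hy).elim (fun h => h.1) (fun h => absurd h.2 (not_lt.2 (by linarith)))

/-- Sign of a function just left of a zero with positive derivative. -/
private theorem eventually_neg_left_of_hasDerivAt {f : ℝ → ℝ} {x f' : ℝ} (hf : HasDerivAt f f' x) (hx : f x = 0) (hf' : 0 < f') :
    ∃ δ > 0, ∀ y, x - δ < y → y < x → f y < 0 := by
  have ht := (hasDerivAt_iff_tendsto_slope.1 hf).eventually (lt_mem_nhds hf')
  rw [eventually_nhdsWithin_iff, Metric.eventually_nhds_iff] at ht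
  obtain ⟨δ, hδ, hδ'⟩ := ht
  refine ⟨δ, hδ, fun y hxy hyx => ?_⟩
  have hy : 0 < slope f x y := hδ' (by rw [Real.dist_eq, abs_of_neg (by linarith)]; linarith) (ne_of_lt hyx)
  rw [slope_def_field, hx, sub_zero] at hy
  exact (div_pos_iff.1 hy).elim (fun h => absurd h.2 (not_lt.2 (by linarith))) (fun h => h.1)

/-- **BINOMIAL-LEAD CELL (NOTE §56.10 (1), «C1») — the pen g9 Sketch-T3-s59 `BinomialLeadAtMostOne`, VERBATIM**: a binomial
negative row `−α + γX^c` times any `k` zero-change rows has at most ONE positive critical point. -/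
theorem binomialLeadAtMostOne : ∀ (k a c : ℕ), 0 < a → a < c → ∀ (α γ : ℝ) (p q s : Fin k → ℝ),
    0 < α → 0 < γ → (∀ i, 0 < p i ∧ 0 ≤ q i ∧ 0 ≤ s i) →
    posCrit (row a c (-α) 0 γ * ∏ i, row a c (p i) (q i) (s i)) ≤ 1 := by
  intro k a c ha hac α γ p q s hα hγ h
  classical
  have hc : 0 < c := ha.trans hac
  -- the company as a `Fin (k+1)`-indexed product
  set co : Fin (k + 1) → ℝ × ℝ × ℝ := Fin.cons ((-α, 0, γ) : ℝ × ℝ × ℝ) (fun i => (p i, q i, s i)) with hco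
  set Φ : ℝ[X] := row a c (-α) 0 γ * ∏ i, row a c (p i) (q i) (s i) with hΦ
  have hΦco : Φ = ∏ j, row a c (co j).1 (co j).2.1 (co j).2.2 := by
    rw [hΦ, Fin.prod_univ_succ]
    simp [hco]
  -- the zero-change block B and its derivative are ≥ 0 on (0,∞), B > 0
  set B : ℝ[X] := ∏ i, row a c (p i) (q i) (s i) with hB
  have hBpos : ∀ t, 0 < t → 0 < B.eval t := by
    intro t ht
    rw [hB, eval_prod]
    exact prod_pos fun i _ => eval_row_pos' (h i).1 (h i).2.1 (h i).2.2 ht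
  have hBcoef : ∀ n, 0 ≤ B.coeff n :=
    coeff_nonneg_prod _ _ (fun i _ n => coeff_row_nonneg (h i).1.le (h i).2.1 (h i).2.2 n)
  have hB'nn : ∀ t, 0 < t → 0 ≤ (derivative B).eval t := fun t ht =>
    eval_nonneg_of_coeff_nonneg (fun n => by rw [coeff_derivative]; exact mul_nonneg (hBcoef _) (by positivity)) ht.le
  -- the W row
  have hW : ∀ t, (row a c (-α) 0 γ).eval t = -α + γ * t ^ c := by intro t; simp [row]
  have hW' : ∀ t, t * (derivative (row a c (-α) 0 γ)).eval t = (c : ℝ) * γ * t ^ c := by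
    intro t; rw [mul_eval_derivative_row]; ring
  -- every positive critical point has g_W < 0
  have hcrit_neg : ∀ t, 0 < t → (derivative Φ).eval t = 0 → (row a c (-α) 0 γ).eval t < 0 := by
    intro t ht hd
    by_contra hge
    push Not at hge
    have hd' : (derivative Φ).eval t = (derivative (row a c (-α) 0 γ)).eval t * B.eval t +
        (row a c (-α) 0 γ).eval t * (derivative B).eval t := by
      rw [hΦ, derivative_mul, eval_add, eval_mul, eval_mul]
    have hgW' : 0 < (derivative (row a c (-α) 0 γ)).eval t := by
      have := hW' t
      have h2 : 0 < (c : ℝ) * γ * t ^ c := by positivity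
      nlinarith
    have : 0 < (derivative Φ).eval t := by
      rw [hd']
      nlinarith [mul_pos hgW' (hBpos t ht), mul_nonneg hge (hB'nn t ht)]
    linarith
  -- every positive critical point is a strict local maximum of |Φ|: Φ'' > 0 there (Φ < 0)
  have hmax : ∀ t, 0 < t → (derivative Φ).eval t = 0 → 0 < (derivative (derivative Φ)).eval t := by
    intro t ht hd
    have hgW := hcrit_neg t ht hd
    have hΦt : Φ.eval t < 0 := by
      rw [hΦ, eval_mul]; exact mul_neg_of_neg_of_pos hgW (hBpos t ht)
    have hM : 0 ≤ middleSum a c co t := by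
      rw [middleSum, Fin.sum_univ_succ]
      simp only [hco, Fin.cons_zero, Fin.cons_succ, zero_mul, zero_div, zero_add]
      exact sum_nonneg fun i _ => div_nonneg (mul_nonneg (h i).2.1 (pow_nonneg ht.le a))
        (eval_row_pos' (h i).1 (h i).2.1 (h i).2.2 ht).le
    have hj : ∃ j, t * (derivative (row a c (co j).1 (co j).2.1 (co j).2.2)).eval t ≠ 0 := by
      refine ⟨0, ?_⟩
      simp only [hco, Fin.cons_zero]
      rw [hW' t]; positivity
    have hΦne : (∏ j, row a c (co j).1 (co j).2.1 (co j).2.2).eval t ≠ 0 := by rw [← hΦco]; exact hΦt.ne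
    have hd' : (derivative (∏ j, row a c (co j).1 (co j).2.1 (co j).2.2)).eval t = 0 := by rw [← hΦco]; exact hd
    have hcc := concavityCriterion_of_nonneg (k + 1) a c ha hac co ht hΦne hd' hM hj
    rw [← hΦco] at hcc
    nlinarith
  -- hence at most one positive critical point
  rw [posCrit]
  by_contra hcard
  push Not at hcard
  set F := (derivative Φ).roots.toFinset.filter (fun t => 0 < t) with hF
  have hD0 : derivative Φ ≠ 0 := by
    intro h0; rw [hF, h0] at hcard; simp at hcard
  have hmemF : ∀ {t}, t ∈ F ↔ 0 < t ∧ (derivative Φ).eval t = 0 := by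
    intro t; rw [hF, mem_filter, Multiset.mem_toFinset, mem_roots hD0, IsRoot.def, and_comm]
  have hFne : F.Nonempty := by rw [← Finset.card_pos]; omega
  set t₁ := F.min' hFne with ht₁
  have ht₁F : t₁ ∈ F := min'_mem F hFne
  have hF'ne : (F.erase t₁).Nonempty := by
    rw [← Finset.card_pos, card_erase_of_mem ht₁F]; omega
  set t₂ := (F.erase t₁).min' hF'ne with ht₂
  have ht₂F' : t₂ ∈ F.erase t₁ := min'_mem _ hF'ne
  have ht₂F : t₂ ∈ F := mem_of_mem_erase ht₂F'
  have h12 : t₁ < t₂ := lt_of_le_of_ne (min'_le F t₂ ht₂F) (ne_of_mem_erase ht₂F').symm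
  have hgap : ∀ r, r ∈ F → t₁ < r → t₂ ≤ r := fun r hr h1r =>
    min'_le _ r (mem_erase.2 ⟨ne_of_gt h1r, hr⟩)
  obtain ⟨h1pos, h1root⟩ := hmemF.1 ht₁F
  obtain ⟨h2pos, h2root⟩ := hmemF.1 ht₂F
  -- Φ′ > 0 just right of t₁, Φ′ < 0 just left of t₂
  obtain ⟨δ₁, hδ₁, hright⟩ := eventually_pos_right_of_hasDerivAt ((derivative Φ).hasDerivAt t₁) h1root (hmax t₁ h1pos h1root)
  obtain ⟨δ₂, hδ₂, hleft⟩ := eventually_neg_left_of_hasDerivAt ((derivative Φ).hasDerivAt t₂) h2root (hmax t₂ h2pos h2root)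
  set u₁ := min (t₁ + δ₁ / 2) ((t₁ + t₂) / 2) with hu₁
  set u₂ := max (t₂ - δ₂ / 2) ((t₁ + t₂) / 2) with hu₂
  have hu₁gt : t₁ < u₁ := lt_min (by linarith) (by linarith)
  have hu₂lt : u₂ < t₂ := max_lt (by linarith) (by linarith)
  have hu12 : u₁ ≤ u₂ := (min_le_right _ _).trans (le_max_right _ _)
  have hpos₁ : 0 < (derivative Φ).eval u₁ := hright u₁ hu₁gt (lt_of_le_of_lt (min_le_left _ _) (by linarith))
  have hneg₂ : (derivative Φ).eval u₂ < 0 := hleft u₂ (lt_of_lt_of_le (by linarith) (le_max_left _ _)) hu₂lt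
  -- a root of Φ′ strictly between t₁ and t₂: contradiction
  obtain ⟨r, hr, hr0⟩ : ∃ r ∈ Set.Icc u₁ u₂, (derivative Φ).eval r = 0 :=
    intermediate_value_Icc' hu12 (derivative Φ).continuousOn_aeval ⟨hneg₂.le, hpos₁.le⟩
  have hrpos : 0 < r := h1pos.trans (hu₁gt.trans_le hr.1)
  have hrF : r ∈ F := hmemF.2 ⟨hrpos, hr0⟩
  have := hgap r hrF (hu₁gt.trans_le hr.1)
  linarith [hr.2]

end ZeroChange

end Summit.ValiantsHypothesis.ValiantsHypothesis.Theorems.LacunarySymmetroidMatrixDescartes
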